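import Summits.ABC.IUTFork.Cor312IdentifiedCopies
import Summits.ABC.IUTFork.Cor312StatementBridge
import Summits.ABC.IUTFork.Cor312ScaledCopiesWitness
import HarnessLib

/-!
# READING-PATH (abc-iut-inv-1, cycle-2 lens `deformation`; D-0156 permanent ideation seat) — SKETCH, not a proposal

A typed one-parameter family of PARTIAL READINGS of [IUTchIII] Cor. 3.12 Step (xi) between READING SS
(`Cor312.Setting.IdentifiedReading`, frozen a8c10ac14b9cae09; [cite: ScholzeStix2018, §2.2 pp. 9–10]) and READING M
(distinct, honestly `j²`-scaled copies + (Ind1)(Ind2)(Ind3); `Cor312.ScaledCopies.ssSetting_scaled`), indexed by a CLASS `D`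
of allowed ℚ-linear DISPLACEMENTS between the label-`j` Kummer image of the Θ-pilot and the q-pilot image, plus the three
monotone quantities (q1) = READING R3 «the q-image is a possible image» (the reading-level proxy of the q-glue (b2),
`Thm311ToCor312.qRegion_mem_possibleImages_of_gluedRegions` / `not_gluedRegions_of_not_mem_possibleImages`), (q2) =
«the Θ-volume encodes weight `w` up to blur `B`», (q3) = the typed `Statement`; and the BLUR THRESHOLD `B ≥ (w − 1)·|log(q)|`
forced by (q1) (the interface-level form of Scholze–Stix's «blurring of at least O(ℓ²)», barrier clause (b3)).
OUR typed interpolation — neither author's claim; TAKES NO SIDE on Cor. 3.12; typed ≠ proved; NOT an abc claim.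
Defs + theorem statements with short proofs only; no instance / notation; nothing here is proposed to the gate.
-/

set_option linter.dupNamespace false

namespace Summit.ABC.ABC.Cruxes.ThetaPartII.ReadingPath1

open Summit.ABC.IUTFork Summit.ABC.IUTFork.Thm311 Summit.ABC.IUTFork.Cor312

variable {T : ThetaIndex} {S : Situation T}

/-! ## 1. Displacement classes and the partial-reading family -/

/-- A DISPLACEMENT CLASS: for every packet `(j, v_ℚ)` a set of allowed ℚ-linear automorphisms of the packet (the ambient
type of c312-7's indeterminacy families `Setting.indGroup S`, taken packet-wise). -/
def DisplacementClass (S : Situation T) : Type _ :=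
  ∀ (j : T.Label) (vQ : T.VQ), Set (S.L.Packet j vQ ≃ₗ[ℚ] S.L.Packet j vQ)

/-- «Copies within `D`»: every Kummer image of the Θ-pilot (every lattice position `m`, every label, every packet) IS an
allowed displacement of the q-pilot image. `D = {id}` is the `kummer` clause of `IdentifiedReading`. -/
def CopiesWithin (D : DisplacementClass S) (P : Setting S) : Prop :=
  ∀ (m : ℤ) (j : T.Label) (vQ : T.VQ), ∃ φ ∈ D j vQ, P.thetaRegion m j vQ = φ '' P.qRegion j vQ

/-- **PARTIAL READING at displacement class `D`**: `IdentifiedReading` with its `kummer` clause relaxed to «copies within `D`»;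
the clauses `indFixes` (the (Ind1)(Ind2)-group acts along the identity on the q-image) and `hasHull` are kept verbatim. -/
structure PartialReading (D : DisplacementClass S) (P : Setting S) : Prop where
  copies : CopiesWithin D P
  indFixes : ∀ Φ ∈ Setting.indGroup S, ∀ (j : T.Label) (vQ : T.VQ), Φ j vQ '' P.qRegion j vQ = P.qRegion j vQ
  hasHull : ∀ (j : T.Label) (vQ : T.VQ), (P.frame j vQ).HasHull (P.qRegion j vQ)

/-- Rung 0 — the identity only (READING SS). -/
def idClass (S : Situation T) : DisplacementClass S := fun j vQ => {LinearEquiv.refl ℚ (S.L.Packet j vQ)}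

/-- Rung 1 — identification up to the units `±1` of the value-group scalar (MJ-HARVEST-1 H1-12 `KummerScalarRigidity`: `k^×`-rigidity
is exactly `±1`; the (Ind1)(Ind2)-groups of the toy settings of record act by signs, `actsBySigns_of_mem_closure`). -/
def signClass (S : Situation T) : DisplacementClass S := fun _ _ =>
  {φ | ∀ x, φ x = x} ∪ {φ | ∀ x, φ x = -x}

/-- Rung 2 — identification up to the TYPED indeterminacies: the packet components of c312-7's `Setting.indGroup S`
(⟨(Ind1) ∪ (Ind2)⟩; contains the strip groups of the `Thm311RealInd1StripPacket*` files and, at the DH packets, the lattice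
automorphisms inv-2's A1 object bounds). -/
def indClass (S : Situation T) : DisplacementClass S := fun j vQ => {φ | ∃ Φ ∈ Setting.indGroup S, Φ j vQ = φ}

/-- Rung 3 — identification up to a non-zero rational DILATION of the packet (value-group rescaling; the honest `j²`-copies of
READING M are the dilations by `q^{j²−1}`: `ssSetting`, `NaiveWitness.glueSetting p k`, `PinnedWitness.pinnedSetting p`). -/
def dilationClass (S : Situation T) : DisplacementClass S := fun _ _ => {φ | ∃ c : ℚ, c ≠ 0 ∧ ∀ x, φ x = c • x}

/-- Top rung — every displacement. -/
def univClass (S : Situation T) : DisplacementClass S := fun _ _ => Set.univ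

theorem copiesWithin_mono {D D' : DisplacementClass S} (h : ∀ j vQ, D j vQ ⊆ D' j vQ) {P : Setting S}
    (hP : CopiesWithin D P) : CopiesWithin D' P := fun m j vQ => by
  obtain ⟨φ, hφ, e⟩ := hP m j vQ
  exact ⟨φ, h j vQ hφ, e⟩

/-- The family is MONOTONE in `D`. -/
theorem PartialReading.mono {D D' : DisplacementClass S} (h : ∀ j vQ, D j vQ ⊆ D' j vQ) {P : Setting S}
    (hP : PartialReading D P) : PartialReading D' P :=
  ⟨copiesWithin_mono h hP.copies, hP.indFixes, hP.hasHull⟩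

/-- Rung 0 IS Reading SS: `PartialReading {id} P ↔ P.IdentifiedReading`. -/
theorem partialReading_idClass_iff (P : Setting S) : PartialReading (idClass S) P ↔ P.IdentifiedReading := by
  constructor
  · intro h
    refine ⟨fun m j vQ => ?_, h.indFixes, h.hasHull⟩
    obtain ⟨φ, hφ, e⟩ := h.copies m j vQ
    have hφ' : φ = LinearEquiv.refl ℚ _ := hφ
    rw [e, hφ']
    ext x
    simp
  · intro h
    refine ⟨fun m j vQ => ⟨LinearEquiv.refl ℚ _, rfl, ?_⟩, h.indFixes, h.hasHull⟩
    rw [h.kummer m j vQ]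
    ext x
    simp

/-- Rung 2 COLLAPSES onto rung 0: because the indeterminacies act along the identity on the q-image (`indFixes`), «copies
within the typed (Ind1)(Ind2)-displacements» is already the identified reading. -/
theorem partialReading_indClass_iff (P : Setting S) : PartialReading (indClass S) P ↔ P.IdentifiedReading := by
  constructor
  · intro h
    refine ⟨fun m j vQ => ?_, h.indFixes, h.hasHull⟩
    obtain ⟨φ, ⟨Φ, hΦ, rfl⟩, e⟩ := h.copies m j vQ
    rw [e, h.indFixes Φ hΦ j vQ]
  · intro h
    refine ⟨fun m j vQ => ⟨(1 : ∀ (j : T.Label) (vQ : T.VQ), S.L.Packet j vQ ≃ₗ[ℚ] S.L.Packet j vQ) j vQ,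
      ⟨1, (Setting.indGroup S).one_mem, rfl⟩, ?_⟩, h.indFixes, h.hasHull⟩
    rw [h.kummer m j vQ]
    ext x
    simp

/-! ## 2. The three quantities and the blur threshold -/

/-- (q1) READING R3 at the labels `j = i+1 ∈ 𝔽_ℓ^⋇`: the q-pilot image is a possible image of the Θ-pilot object — the
reading-level consequence of the q-glue (b2) (`qRegion_mem_possibleImages_of_gluedRegions`) whose failure kills (b1) ∧ (b2) for every
region algorithm and column (`not_gluedRegions_of_not_mem_possibleImages`). -/
def Q1 (P : Setting S) : Prop :=
  ∀ (i : Fin T.lstar) (vQ : T.VQ), P.qRegion (Setting.labelSucc i) vQ ∈ P.possibleImages _ vQ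

/-- (q2) CONTENT UP TO BLUR: the printed `−|log(Θ)|` is at most the `w`-weighted `−|log(q)|` plus `B` («the Θ-volume reflects
Θ-degrees of average weight `w`, blurred by at most `B`»; `w = stepVWeight T`, `B = 0` is the faithful Step (v) computation
`ssSetting_negLogTheta_eq_weight`; R-1's exact encoding is the case `B = 0` with equality). -/
def EncodesUpTo (w B : ℝ) (P : Setting S) : Prop :=
  P.negLogTheta ≤ ((w * P.negLogQ + B : ℝ) : WithTop ℝ)

/-- **BLUR THRESHOLD.** If the typed Corollary holds and the Θ-volume encodes weight `w` up to blur `B`, then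
`(w − 1)·|log(q)| ≤ B`: content of weight `w > 1` costs blur at least the Step-(v) excess. (Pure rearrangement of the two printed
numbers; the per-packet forms are of record: `ForkLocalGlobal` l.72, `Cor312GapGlobalCountermodel` l.132, and at honest pinned
settings `PinnedHonest.statement_iff_hullInflation`.) -/
theorem blurThreshold_of_statement {P : Setting S} (hS : P.Statement) (hq : P.AbsLogQPos) {w B : ℝ}
    (hE : EncodesUpTo w B P) : (w - 1) * P.absLogQ ≤ B := by
  have h1 : ((P.negLogQ : ℝ) : WithTop ℝ) ≤ ((w * P.negLogQ + B : ℝ) : WithTop ℝ) := le_trans hS.2 hE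
  have h2 : P.negLogQ ≤ w * P.negLogQ + B := WithTop.coe_le_coe.mp h1
  have h3 : P.absLogQ = -P.negLogQ := by
    unfold Setting.absLogQ
    exact abs_of_neg hq
  rw [h3]
  nlinarith

/-- **SHARPNESS UNDER THE q-GLUE (EXCLUDING direction).** Under the bridge hypotheses, READING R3 (hence the q-glue (b2)) forces
the blur threshold for EVERY weight: no partial reading with (b2) can carry content of weight `w` with blur below `(w − 1)·|log(q)|`
— at `w = stepVWeight T` this is `((ℓ⋇+1)(2ℓ⋇+1)/6 − 1)·|log(q)| = O(ℓ²)·|log(q)|`, barrier clause (b3). -/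
theorem blurThreshold_of_q1 {P : Setting S} (H : Cor312Vol.BridgeHyps P) (h1 : Q1 P) (hq : P.AbsLogQPos) {w B : ℝ}
    (hE : EncodesUpTo w B P) : (w - 1) * P.absLogQ ≤ B :=
  blurThreshold_of_statement (Cor312Vol.statement_of_qRegion_mem_possibleImages H h1) hq hE

/-- In particular under R3 no EXACT encoding of any weight `w > 1` survives (R-1's `IdentifiedReading.not_encodes` needs only R3,
not the identification). -/
theorem not_encodesUpTo_zero_of_q1 {P : Setting S} (H : Cor312Vol.BridgeHyps P) (h1 : Q1 P) (hq : P.AbsLogQPos) {w : ℝ}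
    (hw : 1 < w) : ¬ EncodesUpTo w 0 P := fun hE => by
  have h := blurThreshold_of_q1 H h1 hq hE
  have hpos : 0 < P.absLogQ := by
    unfold Setting.absLogQ
    exact abs_pos.mpr (ne_of_lt hq)
  nlinarith

/-- The KEY's iff-form of sharpness, typed (a CANDIDATE row; see the memo: it is FALSE as an iff at the separating settings of
record `sepSetting` / `lgSetting` / `glueSetting p 0`, where (q1) fails AND the Corollary is true without content — the valid kernel
form is the one-directional `blurThreshold_of_q1`). -/
def SharpIff (D : DisplacementClass S) (w : ℝ) : Prop :=
  ∀ P : Setting S, PartialReading D P → Cor312Vol.BridgeHyps P → P.AbsLogQPos → (Q1 P ↔ ¬ EncodesUpTo w 0 P)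

/-! ## 3. New one-line cells of the threshold table (typed; proofs where cheap) -/

/-- CELL (ssSetting, rung): the honest scaled-copies witness lies on rung 3 — its Θ-copies are the dilations of the q-image by
`2^{−(j²−1)}` (typed; proof = `line` is a linear equivalence and `ballR k = {|line x| ≤ 2^{−k}}`). -/
def SSWithinDilations : Prop := CopiesWithin (dilationClass ScaledCopies.ssSituation) ScaledCopies.ssSetting

/-- CELL (ssSetting, q1): READING R3 fails at the honest witness (the possible images at label 2 are `{ballR 4}`, the q-image is
`ballR 1`). -/
theorem not_q1_ssSetting : ¬ Q1 ScaledCopies.ssSetting := by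
  intro h
  have hmem := h ⟨1, by decide⟩ ()
  have hsub : ScaledCopies.ssSetting.qRegion (Setting.labelSucc ⟨1, by decide⟩) () ⊆
      ⋃₀ ScaledCopies.ssSetting.possibleImages (Setting.labelSucc ⟨1, by decide⟩) () :=
    Set.subset_sUnion_of_mem hmem
  rw [ScaledCopies.ssSetting_sUnion_possibleImages, ScaledCopies.ssSetting_qRegion] at hsub
  have hle := (ScaledCopies.ballR_subset_ballR_iff _ _).mp hsub
  exact absurd hle (by decide)

/-- CELL (any `P.identify`-type or identified setting, q2): weight-`w` content with zero blur is absent under R3 — instance of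
`not_encodesUpTo_zero_of_q1`; at `nvSetting` / `linkIdSetting` / `.identify` the record gives the stronger `negLogTheta_eq`. -/
def IdentifiedNoContent (P : Setting S) : Prop := ∀ w : ℝ, 1 < w → ¬ EncodesUpTo w 0 P

/-- CELL (third reading, interface level): «some setting on rung `D` has (q1) ∧ (q3) ∧ content of weight `w` up to blur `B`».
By `blurThreshold_of_q1` it is EMPTY for `B < (w−1)·|log(q)|`; for `B ≥ (w−1)·|log(q)|` it is inhabited trivially (blur swallows
the scaling: the growing-column bed `Repair.growSettingE`, `growE_statement_iff` / `growE_reading3_iff`, at the price of typed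
Thm. 3.11 (ii)(b) `KummerB`, `grow_not_kummerB`). -/
def ThirdReadingAt (D : DisplacementClass S) (w B : ℝ) : Prop :=
  ∃ P : Setting S, PartialReading D P ∧ Cor312Vol.BridgeHyps P ∧ P.AbsLogQPos ∧ Q1 P ∧ P.Statement ∧ EncodesUpTo w B P

/-- The third-reading cell below the threshold is empty (kernel, every `D`). -/
theorem not_thirdReadingAt_of_lt (D : DisplacementClass S) {w B : ℝ}
    (hB : ∀ P : Setting S, P.AbsLogQPos → B < (w - 1) * P.absLogQ) : ¬ ThirdReadingAt D w B := by
  rintro ⟨P, -, H, hq, h1, -, hE⟩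
  exact absurd (blurThreshold_of_q1 H h1 hq hE) (not_le.mpr (hB P hq))

/-! ## 4. Name pins (the record this sketch leans on; elaboration = the names exist with these shapes) -/

example (P : Setting S) (hP : P.IdentifiedReading) : P.negLogTheta = ((P.negLogQ : ℝ) : WithTop ℝ) := hP.negLogTheta_eq
example : ¬ ScaledCopies.ssSetting.IdentifiedReading := ScaledCopies.ssSetting_not_identifiedReading
example : ¬ ScaledCopies.ssSetting.Statement := ScaledCopies.ssSetting_not_statement
open Summit.ABC.IUTFork.Cor312.Checks Summit.ABC.IUTFork.Cor312.IdentifiedNonVacuity in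
example : ScaledCopies.ssSetting.negLogTheta =
    ((stepVWeight toyIndex * ScaledCopies.ssSetting.negLogQ : ℝ) : WithTop ℝ) := ScaledCopies.ssSetting_negLogTheta_eq_weight

end Summit.ABC.ABC.Cruxes.ThetaPartII.ReadingPath1
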